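import Literature.Computability.Cryptography.InfrastructureWalkFP
import HarnessLib

/-!
# The class-group table of the pure cubic class-number algorithm (definitions)

Topic `Computability/Cryptography`; DEFINITIONS ONLY (the operational form of the table that the class-group stage of
the crux `LinnikCubicClassGroups.PureCubicClassGroupFBQP`, line `arakelov-giant-step-cycle`, Fourier-samples), written over
abstract walk programs so that (i) its polynomial-time computability is a pure `CodeFP` composition, (ii) its semantics
(a shift-cell table with coset structure off a small defect set, `PeriodFinding.corrMass_shiftCell`) is number theory,
and (iii) both statements stay short by referring to `classTableOp` by name.

Layout of a position `v` (low to high): `T = 3|ps|` exponent digits `e_t` in base `M = 2^ℓe`, the grid index `j < 2^ℓy`,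
the coin block `κ < 2^ℓκ` (per prime `i`, `ℓb` coins: the bits `iℓb … iℓb+ℓb−1` of `κ`), padding above. Value: from the
cube roots of `m` modulo each prime (`roots`, coins) the degree-one prime codes (`primeL`) `𝔤_1,…` (padded with the unit code
`ord` to exactly `T` generators), each reduced once (`redL`; a code with its `2^prec`-scaled log), the reduced representative
`b_e` of `∏ 𝔤_t^{e_t}` by square-and-multiply with the one-step product-and-reduce `starC`, positions ADDED along the way;
the integer target `t̂ = (j mod 2^s)·r·2^{prec−k−s}` (`R̂ = r/2^k` the regulator advice, `S' = 2^s` grid points per period),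
the shift `Δ = (t̂ − pos b_e) mod R̂·2^prec`, the principal walk `finalI` of the integer walk operations `O` (the same term as in
the regulator part) to `Δ − margin`, one `starC`, then `Bb` guarded baby steps towards `t* = pos b_e + Δ`, and finally the
cell index `(t* − pos) / 2^{prec − n''}`. [Hallgren 2005, §4; Buchmann–Williams 1988, §3; this tree's
`InfrastructureWalkFP.lean`]

## References

* S. Hallgren, STOC 2005, §4. [Hallgren2005]
* J. Buchmann, H. C. Williams, *On the infrastructure of the principal ideal class of an algebraic number field of unit
  rank one*, Math. Comp. 50 (1988), §3. [BuchmannWilliams1988]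
-/

namespace Literature.Computability.Cryptography

namespace CubicClassTable

/-- Lattice codes. [folklore] -/
abbrev Lat : Type := ℕ × List ℤ

/-- A lattice code with a `2^prec`-scaled position. [folklore] -/
abbrev PLat : Type := Lat × ℤ

/-- **The walk programs the table is written over** (all supplied by other parts of the line: cube roots modulo `p`,
degree-one prime codes, lattice product, one reduction step, and the three filtered principal-cycle programs).
[cite: Hallgren2005, §4] -/
structure WalkFns where
  /-- sorted cube roots of `m` mod `p` from coins: `(p, m, κ) ↦ roots` -/
  roots : ℕ × ℕ × List Bool → List ℕ
  /-- degree-one prime code: `((a,b),(ord,(p,r))) ↦ code of p𝓞 + (θ − r)𝓞` -/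
  primeL : (ℕ × ℕ) × (Lat × (ℕ × ℕ)) → Lat
  /-- lattice product: `((a,b),(c₁,c₂)) ↦ code of the ℤ-span of products` -/
  latProd : (ℕ × ℕ) × (Lat × Lat) → Lat
  /-- one reduction step: `(((a,b),prec), c) ↦ (code of γ⁻¹I, ≈ 2^prec log σ₁ γ)` -/
  redL : ((ℕ × ℕ) × ℕ) × Lat → PLat
  /-- filtered baby step of the principal cycle (with accumulated log) -/
  rhoS : ((ℕ × ℕ) × ℕ) × Lat → PLat
  /-- filtered giant step of the principal cycle (with accumulated log) -/
  starS : ((ℕ × ℕ) × ℕ) × (Lat × Lat) → PLat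
  /-- first big-gap ideal of the principal cycle (with the log offset of the unit label) -/
  unitS : (ℕ × ℕ) × ℕ → PLat

/-- **The instance of the table**: field data, primes, the order code, the regulator advice `r/2^k`, and the layout /
walk parameters (all natural numbers). [cite: Hallgren2005, §4] -/
structure Inst where
  /-- `θ³ = ab²` -/
  a : ℕ
  /-- `θ³ = ab²` -/
  b : ℕ
  /-- `m = f³ab²` (the radicand as given) -/
  m : ℕ
  /-- the rational primes -/
  ps : List ℕ
  /-- canonical code of `𝓞_K` -/
  ord : Lat
  /-- regulator advice numerator: `|r − 2^k R| ≤ 1` -/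
  r : ℕ
  /-- its precision -/
  k : ℕ
  /-- working precision of logs (`2^prec`) -/
  prec : ℕ
  /-- `S' = 2^s` grid points per period -/
  s : ℕ
  /-- `M = 2^ℓe` (exponent digit size) -/
  ℓe : ℕ
  /-- `N'' = 2^npp` cells per unit distance -/
  npp : ℕ
  /-- `Q_y = 2^ℓy` -/
  ℓy : ℕ
  /-- coin block length (total) -/
  ℓκ : ℕ
  /-- coins per prime -/
  ℓb : ℕ
  /-- start-up rounds of the principal walk -/
  s₀ : ℕ
  /-- doubling levels of the principal walk -/
  Tdbl : ℕ
  /-- final rounds of the principal walk -/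
  Bfin : ℕ
  /-- guarded baby steps after the last product -/
  Bb : ℕ
  /-- safety margin of the principal walk target (`2^prec`-scaled) -/
  margin : ℕ

namespace WalkFns

variable (F : WalkFns)

/-- The integer walk operations of the principal cycle assembled from the programs (LITERALLY the term of the regulator
part of the line: clamped defect evaluator, `KInt = 2^prec (10 size(ab) + 48)`). [cite: Hallgren2005, §4] -/
noncomputable def O : IntWalkOps ((ℕ × ℕ) × ℕ) Lat :=
  ⟨fun d => (F.unitS d).1, fun d c => (F.rhoS (d, c)).1, fun d c₁ c₂ => (F.starS (d, (c₁, c₂))).1,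
    fun d c => (F.rhoS (d, c)).2,
    fun d c₁ c₂ => max (-((2 ^ d.2 * (10 * Nat.size (d.1.1 * d.1.2) + 48) : ℕ) : ℤ))
      (min (((2 ^ d.2 * (10 * Nat.size (d.1.1 * d.1.2) + 48) : ℕ) : ℤ)) ((F.starS (d, (c₁, c₂))).2 + (F.unitS d).2)),
    fun d => 2 ^ d.2 * (10 * Nat.size (d.1.1 * d.1.2) + 48), fun d => d.2⟩

end WalkFns

namespace Inst

variable (I : Inst)

/-- `M = 2^ℓe`. [folklore] -/
def M : ℕ := 2 ^ I.ℓe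

/-- `T = 3 |ps|` generator slots. [folklore] -/
def T : ℕ := 3 * I.ps.length

/-- `W = M^T`, the size of the exponent block. [folklore] -/
def W : ℕ := I.M ^ I.T

/-- The walk instance `((a,b),prec)`. [folklore] -/
def d : (ℕ × ℕ) × ℕ := ((I.a, I.b), I.prec)

/-- The exponent part `E = v mod W` of a position. [folklore] -/
def Eof (v : ℕ) : ℕ := v % I.W

/-- The grid index `j` of a position. [folklore] -/
def jof (v : ℕ) : ℕ := (v / I.W) % 2 ^ I.ℓy

/-- The coin block `κ` of a position. [folklore] -/
def κof (v : ℕ) : ℕ := (v / (I.W * 2 ^ I.ℓy)) % 2 ^ I.ℓκ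

/-- Digit `t` of the exponent part. [folklore] -/
def digit (v t : ℕ) : ℕ := (I.Eof v / I.M ^ t) % I.M

/-- The coins of prime number `i`: bits `iℓb, …, iℓb + ℓb − 1` of `κ`. [folklore] -/
def coins (v i : ℕ) : List Bool := List.ofFn fun q : Fin I.ℓb => Nat.testBit (I.κof v) (i * I.ℓb + q)

/-- The period `R̂ · 2^prec = r · 2^{prec − k}` as an integer. [folklore] -/
def Rint : ℕ := I.r * 2 ^ (I.prec - I.k)

/-- The integer target `t̂_j = (j mod 2^s) · r · 2^{prec − k − s}`. [folklore] -/
def tgt (v : ℕ) : ℕ := (I.jof v % 2 ^ I.s) * I.r * 2 ^ (I.prec - I.k - I.s)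

end Inst

namespace WalkFns

variable (F : WalkFns) (I : Inst)

/-- The generator codes: the degree-one primes above each `p` (roots from the coins), padded with `ord`. [cite: Hallgren2005, §4] -/
def gens (v : ℕ) : List Lat :=
  (List.range I.ps.length).flatMap fun i =>
    (F.roots (I.ps.getD i 0, I.m, I.coins v i)).map fun rt => F.primeL ((I.a, I.b), (I.ord, (I.ps.getD i 0, rt)))

/-- Generator slot `t` (padding slots hold the unit code). [folklore] -/
def gT (v t : ℕ) : Lat := (F.gens I v).getD t I.ord

/-- One reduction step at the instance's precision. [folklore] -/
noncomputable def red (c : Lat) : PLat := F.redL (I.d, c)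

/-- Product-and-reduce with positions added: `(c₁,p₁) ⋆ (c₂,p₂) = (red (c₁c₂)).1, p₁ + p₂ + log`. [cite: BuchmannWilliams1988, §3] -/
noncomputable def starC (p q : PLat) : PLat :=
  ((F.red I (F.latProd ((I.a, I.b), (p.1, q.1)))).1, p.2 + q.2 + (F.red I (F.latProd ((I.a, I.b), (p.1, q.1)))).2)

/-- Square-and-multiply of a reduced generator `g` to the power `n < 2^ℓe` (`none` = the empty product).
[folklore] -/
noncomputable def powC (g : PLat) (n : ℕ) : Option PLat :=
  ((List.range I.ℓe).reverse).foldl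
    (fun acc i =>
      let sq := match acc with
        | none => none
        | some x => some (F.starC I x x)
      if Nat.testBit n i then
        match sq with
        | none => some g
        | some x => some (F.starC I x g)
      else sq)
    none

/-- The reduced representative `b_e` of `∏_t 𝔤_t^{e_t}` with its accumulated position (`(ord, 0)` for `e = 0`).
[cite: Hallgren2005, §4] -/
noncomputable def bE (v : ℕ) : PLat :=
  (((List.range I.T).foldl
    (fun acc t =>
      match F.powC I (F.red I (F.gT I v t)) (I.digit v t) with
      | none => acc
      | some x => match acc with
        | none => some x
        | some y => some (F.starC I y x))
    none).getD (I.ord, 0))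

/-- The forward shift `Δ = ((t̂ − pos b_e) mod R̂2^prec) + R̂2^prec` (one extra lap keeps the walk target positive). [folklore] -/
noncomputable def Δ (v : ℕ) : ℤ := ((I.tgt v : ℤ) - (F.bE I v).2) % (I.Rint : ℤ) + I.Rint

/-- The absolute target `t* = pos b_e + Δ`. [folklore] -/
noncomputable def tstar (v : ℕ) : ℤ := (F.bE I v).2 + F.Δ I v

/-- The principal walk to `Δ − margin` (grid `N = 2^prec`, so that the target integer is a `2^prec`-scaled distance).
[cite: Hallgren2005, §4] -/
noncomputable def J (v : ℕ) : PLat := (O F).finalI I.d (F.Δ I v - I.margin) (2 ^ I.prec) I.s₀ I.Tdbl I.Bfin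

/-- The state after the last product (the principal label's walk distance is shifted by the log offset of the unit label,
`(unitS d).2`, to make it a position relative to `𝓞_K`). [folklore] -/
noncomputable def c0 (v : ℕ) : PLat := F.starC I (F.bE I v) ((F.J I v).1, (F.J I v).2 + (F.unitS I.d).2)

/-- One guarded baby step towards `t*`. [folklore] -/
noncomputable def babyStep (v : ℕ) (st : PLat) : PLat :=
  if st.2 + (F.red I st.1).2 ≤ F.tstar I v then ((F.red I st.1).1, st.2 + (F.red I st.1).2) else st

/-- The final state: `Bb` guarded baby steps. [folklore] -/
noncomputable def cfin (v : ℕ) : PLat := (F.babyStep I v)^[I.Bb] (F.c0 I v)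

/-- **The class-group table** (operational form): the code of the ideal reached and its cell index
`(t* − pos) / 2^{prec − n''}`. [cite: Hallgren2005, §4] -/
noncomputable def classTableOp (v : ℕ) : Lat × ℕ :=
  ((F.cfin I v).1, (F.tstar I v - (F.cfin I v).2).toNat / 2 ^ (I.prec - I.npp))

/-! ### The clamped pipeline

Iterated products with feedback (square-and-multiply, the fold over the generators, the guarded baby steps) are only
polynomially bounded on VALID inputs (canonical codes of reduced ideals); to make the table a total polynomial-time
function its program CLAMPS every lattice code to a size cap `cap` (entries and denominator `≤ cap`, else the unit code):
on valid inputs the clamp never fires (the semantics part of the line proves it), on garbage it keeps the sizes polynomial. -/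

/-- Clamp a lattice code to the cap (else the default code). [folklore] -/
def clampL (cap : ℕ) (dflt : Lat) (c : Lat) : Lat :=
  if c.1 ≤ cap ∧ c.2.all (fun h => decide (h.natAbs ≤ cap)) then c else dflt

/-- Clamped reduction step. [folklore] -/
noncomputable def redc (cap : ℕ) (c : Lat) : PLat := (clampL cap I.ord (F.red I c).1, (F.red I c).2)

/-- Clamped product-and-reduce. [folklore] -/
noncomputable def starCc (cap : ℕ) (p q : PLat) : PLat :=
  ((F.redc I cap (clampL cap I.ord (F.latProd ((I.a, I.b), (p.1, q.1))))).1,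
    p.2 + q.2 + (F.redc I cap (clampL cap I.ord (F.latProd ((I.a, I.b), (p.1, q.1))))).2)

/-- Clamped square-and-multiply. [folklore] -/
noncomputable def powCc (cap : ℕ) (g : PLat) (n : ℕ) : Option PLat :=
  ((List.range I.ℓe).reverse).foldl
    (fun acc i =>
      let sq := match acc with
        | none => none
        | some x => some (F.starCc I cap x x)
      if Nat.testBit n i then
        match sq with
        | none => some g
        | some x => some (F.starCc I cap x g)
      else sq)
    none

/-- Clamped `b_e`. [folklore] -/
noncomputable def bEc (cap : ℕ) (v : ℕ) : PLat :=
  (((List.range I.T).foldl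
    (fun acc t =>
      match F.powCc I cap (F.redc I cap (F.gT I v t)) (I.digit v t) with
      | none => acc
      | some x => match acc with
        | none => some x
        | some y => some (F.starCc I cap y x))
    none).getD (I.ord, 0))

/-- Clamped shift `Δ`. [folklore] -/
noncomputable def Δc (cap : ℕ) (v : ℕ) : ℤ := ((I.tgt v : ℤ) - (F.bEc I cap v).2) % (I.Rint : ℤ) + I.Rint

/-- Clamped absolute target. [folklore] -/
noncomputable def tstarc (cap : ℕ) (v : ℕ) : ℤ := (F.bEc I cap v).2 + F.Δc I cap v

/-- The principal walk for the clamped shift. [folklore] -/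
noncomputable def Jc (cap : ℕ) (v : ℕ) : PLat := (O F).finalI I.d (F.Δc I cap v - I.margin) (2 ^ I.prec) I.s₀ I.Tdbl I.Bfin

/-- Clamped state after the last product. [folklore] -/
noncomputable def c0c (cap : ℕ) (v : ℕ) : PLat :=
  F.starCc I cap (F.bEc I cap v) ((F.Jc I cap v).1, (F.Jc I cap v).2 + (F.unitS I.d).2)

/-- Clamped guarded baby step. [folklore] -/
noncomputable def babyStepc (cap : ℕ) (v : ℕ) (st : PLat) : PLat :=
  if st.2 + (F.redc I cap st.1).2 ≤ F.tstarc I cap v then ((F.redc I cap st.1).1, st.2 + (F.redc I cap st.1).2) else st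

/-- Clamped final state. [folklore] -/
noncomputable def cfinc (cap : ℕ) (v : ℕ) : PLat := (F.babyStepc I cap v)^[I.Bb] (F.c0c I cap v)

/-- **The clamped class-group table** (the form the program computes; equal to `classTableOp` whenever no clamp fires).
[cite: Hallgren2005, §4] -/
noncomputable def classTableOpC (cap : ℕ) (v : ℕ) : Lat × ℕ :=
  ((F.cfinc I cap v).1, (F.tstarc I cap v - (F.cfinc I cap v).2).toNat / 2 ^ (I.prec - I.npp))

/-! ### The power walk (no giant-step descent)

The principal ideal at distance `≈ Δ` is reached WITHOUT the descent `finalI`: one filtered step from the unit label gives a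
principal reduced ideal `h⋆` at position `o⋆ ≥ 2^prec log(11/10)` (big-gap filter), and `h⋆^n`, `n = ⌊(Δ − margin)/o⋆⌋`, computed by
the clamped square-and-multiply, sits at position `n o⋆` up to the accumulated defects (`≤ 2 log₂ n` of them). This keeps the
class table free of any validity bookkeeping for the descent: only clamped products with feedback. -/

/-- The position of `h⋆` = one filtered step beyond the unit label, relative to `𝓞_K` (log offset of the unit label added). [folklore] -/
noncomputable def ostar : ℤ := (F.unitS I.d).2 + (F.rhoS (I.d, (F.unitS I.d).1)).2

/-- `h⋆` with its position. [folklore] -/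
noncomputable def hstar : PLat := ((F.rhoS (I.d, (F.unitS I.d).1)).1, F.ostar I)

/-- The number of steps `n = ⌊(Δ − margin)/o⋆⌋` (as a natural number; `0` if negative). [folklore] -/
noncomputable def nsteps (cap : ℕ) (v : ℕ) : ℕ := ((F.Δc I cap v - I.margin) / F.ostar I).toNat

/-- Clamped square-and-multiply with an ARBITRARY exponent (bits up to `nbits`). [folklore] -/
noncomputable def powCn (cap nbits : ℕ) (g : PLat) (n : ℕ) : Option PLat :=
  ((List.range nbits).reverse).foldl
    (fun acc i =>
      let sq := match acc with
        | none => none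
        | some x => some (F.starCc I cap x x)
      if Nat.testBit n i then
        match sq with
        | none => some g
        | some x => some (F.starCc I cap x g)
      else sq)
    none

/-- The state after the last product of the power walk: `b_e ⋆ h⋆^n` (just `b_e` if `n = 0`); the exponent has at most
`Tdbl` bits. [folklore] -/
noncomputable def c0p (cap : ℕ) (v : ℕ) : PLat :=
  match F.powCn I cap I.Tdbl (F.hstar I) (F.nsteps I cap v) with
  | none => F.bEc I cap v
  | some x => F.starCc I cap (F.bEc I cap v) x

/-- The final state of the power walk: `Bb` clamped guarded baby steps towards `t⋆`. [folklore] -/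
noncomputable def cfinp (cap : ℕ) (v : ℕ) : PLat := (F.babyStepc I cap v)^[I.Bb] (F.c0p I cap v)

/-- **The class-group table, power-walk form** (the form the line's program computes and its semantics part analyses):
the code of the ideal reached and the cell index `(t⋆ − pos)/2^{prec − n''}`. [cite: Hallgren2005, §4] -/
noncomputable def classTableOpP (cap : ℕ) (v : ℕ) : Lat × ℕ :=
  ((F.cfinp I cap v).1, (F.tstarc I cap v - (F.cfinp I cap v).2).toNat / 2 ^ (I.prec - I.npp))

end WalkFns

end CubicClassTable

end Literature.Computability.Cryptography
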